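import Mathlib
import Summits.Ventures.PercRepro2.TwoHullMasterBlockCheck

/-!
# (MM) on the five-cycle with a chord, the marks at distance two (blind cell PercRepro2,
night-4 g41, 2026-08-29; proofs/NIGHT4-G41.md §3)

The cycle `0–1–3–2–4–0` with the chord `3–4`, `l = 0`, `h = 2`: the smallest 2-connected graph
whose marks are not the branch vertices of its theta structure (the chord joins the inner vertices
`3` and `4` of the two `l`–`h` paths `0–1–3–2` and `0–4–2`) — it is `K₄ − e` with one path
subdivided, has no single-bit keyed cover and is not a theta graph of decorated paths
(NIGHT4-G40.md §13).  `U = {h ∉ H_l}` has 16 configurations and is the disjoint union of three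
monotone cube blocks (`cycleChordBlocks`), readable as a decision tree on colour equalities:
`{01 = 13}` (the whole cycle one class, the chord a free coordinate), `{01 ≠ 13, 32 = 34}` and
`{01 ≠ 13, 32 ≠ 34}` (three vertex switches `{01, 13}`, `{32, 34}`, `{24, 40}`: every inner vertex
owns its blue parent edge towards `l` and its red parent edge towards `h`).  The checker of
TwoHullMasterBlockCheck.lean accepts the cover by a kernel computation; **`twoHullMaster_cycleChord`**
is (MM) for every pair of up-sets, `sw_cycleChord` row (SW) for every mark.
-/

namespace Summit.Ventures.PercRepro2

namespace CycleChord

open Hull LocRows SwCheck BlockCheck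

/-- The five-cycle `0–1–3–2–4–0` with the chord `3–4` on `Fin 5`: edges `01 13 32 24 40 34`
(in this order). -/
def cycleChordEdges : List (Fin 5 × Fin 5) :=
  [(0, 1), (1, 3), (3, 2), (2, 4), (4, 0), (3, 4)]

/-- The cube cover of `U` for `l = 0`, `h = 2`: three blocks `(base, classes)`, bit `i` of a mask =
edge `i` of `cycleChordEdges`; the base of each block is its bottom point (`l` all blue, `h` all
red): bottom `BBRRBB` with the classes `{01, 13, 32, 24, 40}`, `{34}`; bottom `BRRRBB` with
`{01, 13}`, `{32, 34}`, `{24, 40}`; bottom `BRRRBR` with `{01, 13}`, `{32, 24, 40, 34}`. -/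
def cycleChordBlocks : List (ℕ × List ℕ) :=
  [(12, [31, 32]), (14, [3, 36, 24]), (46, [3, 60])]

/-- The checker accepts the cover (kernel computation). -/
theorem checkCover_cycleChord : checkCover cycleChordEdges 0 2 cycleChordBlocks = true := by
  decide +kernel

/-- **(MM) on the five-cycle with a chord**, `l = 0` and `h = 2` at distance two. -/
theorem twoHullMaster_cycleChord : TwoHullMaster (endsOf cycleChordEdges) 0 2 :=
  twoHullMaster_of_checkCover cycleChordEdges 0 2 cycleChordBlocks checkCover_cycleChord

/-- Row (SW) on the five-cycle with a chord for every mark `o`. -/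
theorem sw_cycleChord (o : Fin 5) : Sw (endsOf cycleChordEdges) 0 2 o :=
  sw_of_twoHullMaster o twoHullMaster_cycleChord

end CycleChord

end Summit.Ventures.PercRepro2
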